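import Literature.Probability.RandomPlanarGeometry.SAWPulledLargeForceExpansionZdFirstOrder
import HarnessLib

/-!
# Pulled SAW on `ℤ^{d+1}`: HEIGHT-PROFILE TOOLS for classifying irreducible bridges by cost
# (monotone profiles are reducible; an up-step followed by a down-step revisits a site)

Topic `Literature/Probability/RandomPlanarGeometry` (continues `SAWPulledLargeForceExpansionZdFirstOrder.lean`, whose exclusions
`costCoeffZd_two_four`, and `SAWPulledLargeForceExpansionZdThirdOrder.costCoeffZd_three_five`, argue case by case on the height profile
`hᵢ = ωᵢ(0)`). The three lemmas below are the reusable form of those arguments, intended for the cost-four classification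
(`N_{4,5} = 2d(2d−1)³ − 2d(2d−2)`, `N_{4,6} = 2d(2d−1)`, `N_{4,7} = 0`, hence `c^{(d)}_4 = −4d²(2d+3)` — numerically established, lane
«pcv-sawmu» FINDING-PULLED-LARGE-FORCE addendum 15:20Z; not yet a theorem).

## Contents (all PROVED, standard axioms; no data)
* `revisit_of_up_down`, `revisit_of_down_up`: consecutive steps `+e₀, −e₀` (or `−e₀, +e₀`) of a lattice path return to the site two steps
  earlier — so a SELF-AVOIDING bridge has no such pair (`no_up_down_of_mem_saws`, `no_down_up_of_mem_saws`).
* `heights_mono_of_steps`: stepwise non-decreasing heights are non-decreasing.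
* ★ `not_irreducible_of_monotone`: an irreducible bridge of `ℤ^{d+1}` whose height profile is non-decreasing has final height `≤ 1`
  (equivalently: a monotone profile reaching height `2` has a renewal time — the last index of height `1`).
[cite: DuminilCopinHammond2013, §2.2] [cite: MadrasSlade1993, Definition 1.2.4]

Provenance: lane «pcv-sawmu», a-p3 g15 (2026-08-24).
-/

noncomputable section

open Finset
open scoped BigOperators
open Literature.Probability.LatticeModels
open Literature.Probability.RandomPlanarGeometry.SAW

namespace Literature.Probability.RandomPlanarGeometry.SAW.Zd

/-- `+e₀` then `−e₀` returns to the start. [cite: MadrasSlade1993, Definition 1.2.4] -/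
theorem revisit_of_up_down (d : ℕ) {x y z : Site (d + 1)} (hxy : (zdGraph (d + 1)).Adj x y) (hyz : (zdGraph (d + 1)).Adj y z)
    (h1 : y 0 = x 0 + 1) (h2 : z 0 = y 0 - 1) : z = x := by
  rw [eq_sub_e0_of_adj d hyz h2, eq_add_e0_of_adj d hxy h1, add_sub_cancel_right]

/-- `−e₀` then `+e₀` returns to the start. [cite: MadrasSlade1993, Definition 1.2.4] -/
theorem revisit_of_down_up (d : ℕ) {x y z : Site (d + 1)} (hxy : (zdGraph (d + 1)).Adj x y) (hyz : (zdGraph (d + 1)).Adj y z)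
    (h1 : y 0 = x 0 - 1) (h2 : z 0 = y 0 + 1) : z = x := by
  rw [eq_add_e0_of_adj d hyz h2, eq_sub_e0_of_adj d hxy h1, sub_add_cancel]

/-- A self-avoiding walk has no step pair `+e₀, −e₀`. [cite: MadrasSlade1993, Definition 1.2.4] -/
theorem no_up_down_of_mem_saws (d : ℕ) {n : ℕ} {ω : ℕ → Site (d + 1)} (hω : ω ∈ saws (d + 1) n) {i : ℕ} (hi : i + 2 ≤ n)
    (h1 : ω (i + 1) 0 = ω i 0 + 1) (h2 : ω (i + 2) 0 = ω (i + 1) 0 - 1) : False := by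
  obtain ⟨-, -, hadj, hinj⟩ := mem_saws.1 hω
  have h := revisit_of_up_down d (hadj i (by omega)) (hadj (i + 1) (by omega)) h1 h2
  have := hinj (show i + 2 ∈ {j | j ≤ n} from hi) (show i ∈ {j | j ≤ n} by simp only [Set.mem_setOf_eq]; omega) h
  omega

/-- A self-avoiding walk has no step pair `−e₀, +e₀`. [cite: MadrasSlade1993, Definition 1.2.4] -/
theorem no_down_up_of_mem_saws (d : ℕ) {n : ℕ} {ω : ℕ → Site (d + 1)} (hω : ω ∈ saws (d + 1) n) {i : ℕ} (hi : i + 2 ≤ n)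
    (h1 : ω (i + 1) 0 = ω i 0 - 1) (h2 : ω (i + 2) 0 = ω (i + 1) 0 + 1) : False := by
  obtain ⟨-, -, hadj, hinj⟩ := mem_saws.1 hω
  have h := revisit_of_down_up d (hadj i (by omega)) (hadj (i + 1) (by omega)) h1 h2
  have := hinj (show i + 2 ∈ {j | j ≤ n} from hi) (show i ∈ {j | j ≤ n} by simp only [Set.mem_setOf_eq]; omega) h
  omega

/-- Stepwise non-decreasing heights are non-decreasing. [cite: MadrasSlade1993, Definition 1.2.4] -/
theorem heights_mono_of_steps {n : ℕ} {h : ℕ → ℤ} (hstep : ∀ i < n, h i ≤ h (i + 1)) {i j : ℕ} (hij : i ≤ j) (hj : j ≤ n) :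
    h i ≤ h j := by
  induction j with
  | zero =>
    obtain rfl : i = 0 := by omega
    exact le_rfl
  | succ j ih =>
    rcases Nat.lt_or_ge i (j + 1) with hlt | hge
    · exact le_trans (ih (by omega) (by omega)) (hstep j (by omega))
    · obtain rfl : i = j + 1 := le_antisymm hij hge
      exact le_rfl

/-- ★ **A monotone height profile reaching height two is reducible**: if `ω` is an irreducible bridge of `ℤ^{d+1}` of length `n` with
`h₀ ≤ h₁ ≤ ⋯ ≤ h_n` then `h_n ≤ 1` (the last index of height `1` would be a renewal time). [cite: DuminilCopinHammond2013, §2.2] -/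
theorem not_irreducible_of_monotone (d : ℕ) {n : ℕ} {ω : ℕ → Site (d + 1)} (hω : ω ∈ irreducibleBridges (d + 1) n)
    (hmono : ∀ i < n, ω i 0 ≤ ω (i + 1) 0) (hn : 2 ≤ ω n 0) : False := by
  classical
  obtain ⟨hbr, hI⟩ := mem_irreducibleBridges.1 hω
  obtain ⟨hωs, hb⟩ := mem_bridges.1 hbr
  have h0 : ω 0 = 0 := (mem_saws.1 hωs).1
  have hn1 : 1 ≤ n := hI.1
  have hω1 : ω 1 0 = 1 := by rw [apply_one_eq_e0_of_mem_bridges d hn1 hbr]; simp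
  have hn2 : 2 ≤ n := by
    by_contra h
    obtain rfl : n = 1 := by omega
    rw [hω1] at hn; omega
  have hmono' : ∀ i j, i ≤ j → j ≤ n → ω i 0 ≤ ω j 0 := fun i j hij hj =>
    heights_mono_of_steps (h := fun i => ω i 0) hmono hij hj
  -- `k` = the last index `≤ n - 1` of height `≤ 1`
  set k := Nat.findGreatest (fun i => ω i 0 ≤ 1) (n - 1) with hk
  have hPk : ω k 0 ≤ 1 := Nat.findGreatest_spec (P := fun i => ω i 0 ≤ 1) (m := 1) (by omega) (by rw [hω1])
  have hk1 : 1 ≤ k := Nat.le_findGreatest (P := fun i => ω i 0 ≤ 1) (by omega) (by rw [hω1])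
  have hkn : k ≤ n - 1 := Nat.findGreatest_le (n - 1)
  have hafter : ∀ m, k < m → m ≤ n → 1 < ω m 0 := by
    intro m hkm hmn
    rcases Nat.lt_or_ge m n with hlt | hge
    · have := Nat.findGreatest_is_greatest (P := fun i => ω i 0 ≤ 1) hkm (by omega)
      exact not_le.1 this
    · obtain rfl : m = n := le_antisymm hmn hge
      omega
  refine hI.2.2 k hk1 (by omega) ⟨by omega, fun i hi1 hi2 => ⟨?_, hmono' i k hi2 (by omega)⟩, fun j hj1 hj2 => ⟨?_, ?_⟩⟩
  · exact (hb i hi1 (by omega)).1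
  · exact lt_of_le_of_lt hPk (hafter (k + j) (by omega) (by omega))
  · show ω (k + j) 0 ≤ ω (k + (n - k)) 0
    rw [show k + (n - k) = n by omega]
    exact hmono' (k + j) n (by omega) le_rfl

end Literature.Probability.RandomPlanarGeometry.SAW.Zd
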